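import Literature.InformationTheory.QuantumCodes.LDPCCountingThresholdPrintedConstant
import Summits.Ventures.QEC.Thresholds.LDPCThreshold
import HarnessLib

/-!
# The LDPC-family threshold of `LDPCThreshold.lean` with Gottesman's PRINTED constant `p₀ = (2ze)⁻²`
# (LADDER-QEC Q5; FINDINGS Q5-2 "open (sharpening)" closed)

Venture QEC, `Summits/Ventures/QEC/Thresholds/` (qec-lit-2 g8; companion of qec-type-09's `LDPCThreshold.lean`,
which is left untouched — single-writer rule). `LDPCThreshold.ldpc_isThresholdLowerBound` certifies the threshold
lower bound `1/(4Δ⁴) = (2Δ²)⁻²` for one error type of every CSS (or classical) code family with check graphs of degree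
`≤ Δ` under minimum-weight decoding, the constant coming from the tree's crude animal count `Δ^{2(s-1)}`. The
Literature file `LDPCCountingThresholdPrintedConstant.lean` now proves Gottesman 2014 Lemma 2 (case `t = 1`:
"at most `(ze)^{s-1}` clusters of size `s` through a qubit") and Theorem 3's displayed bound with the constant AS
PRINTED, `p₀ = (2ze)⁻²`. This file repackages that bound in the Q5 vocabulary, with the SAME data and hypotheses as
`ldpc_isThresholdLowerBound`:

* `ldpc_isThresholdLowerBound_printed` — `IsThresholdLowerBound (cssFailureFamily H SX D) (1/(2ze)²)` for check graphs
  of degree `≤ z` (`z ≥ 1`), ANY minimum-weight decoders, `1 ≤ d i ≤` distance, subexponential size;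
* `printedThreshold_le_accuracyThreshold` — hence `(2ze)⁻² ≤ accuracyThreshold (cssFailureFamily H SX D)`;
* `ldpc_isThresholdLowerBound_of_three_le` — for `z ≥ 3` the printed bound implies the earlier one (`1/(4z⁴) ≤ (2ze)⁻²`,
  `animalThreshold_le_printedThreshold`), so this file SUPERSEDES `ldpc_isThresholdLowerBound` there.

HONEST FRAMING: code-capacity model, independent errors of rate `p` (the `cssFailureFamily` of `LDPCThreshold.lean`);
a certified LOWER bound on the threshold by the Peierls/union-bound route, with the constant of the printed theorem;
for CSS codes the DKP15 irreducible-cluster constants of the tree (`4(w-1)²p(1-p) < 1`) remain far better — no census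
cell moves; UNCONDITIONAL, kernel-tier, 0 named facts, no `native_decide`.

## References

* [Gottesman2014] D. Gottesman, Quantum Inf. Comput. 14 (2014) 1338, arXiv:1310.2984, §4 Lemma 2, Thm. 3
  ("Let `p₀ = (2ze)⁻²`. Then for `p < p₀` … the logical error rate approaches `0`").
* [KovalevPryadko2013] A. A. Kovalev, L. P. Pryadko, Phys. Rev. A 87 (2013) 020304(R), arXiv:1208.2317, Thm. 3.
* [DennisEtAl2002] Dennis–Kitaev–Landahl–Preskill, J. Math. Phys. 43 (2002) 4452, §4.3 (threshold definition).
-/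

noncomputable section

namespace Summit.Ventures.QEC.Thresholds

open Filter Topology Finset Matrix
open Literature.InformationTheory.QuantumCodes
open Literature.Probability.LatticeModels

variable {n m : ℕ → ℕ}

/-- The printed threshold is at most `1`: `(2ze)⁻² ≤ 1` for `z ≥ 1` (indeed `≤ 1/(4e²)`).
[cite: Gottesman2014, Thm 3 (p₀ = (2ze)⁻²)] -/
theorem printedThreshold_le_one {z : ℕ} (hz : 1 ≤ z) : 1 / (2 * (z : ℝ) * Real.exp 1) ^ 2 ≤ 1 := by
  have hz1 : (1 : ℝ) ≤ z := by exact_mod_cast hz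
  have he1 : (1 : ℝ) ≤ Real.exp 1 := Real.one_le_exp (by norm_num)
  have h2K : (1 : ℝ) ≤ 2 * (z : ℝ) * Real.exp 1 := by nlinarith
  rw [div_le_one (by positivity)]
  exact one_le_pow₀ h2K

/-- **Certified threshold for bounded-degree (LDPC) families under minimum-weight decoding, PRINTED CONSTANT**
(Gottesman 2014 Thm. 3, `p₀ = (2ze)⁻²`): for one error type of any family of CSS codes with check graphs of degree
`≤ z` (`z ≥ 1`; `z = (r-1)c` for `(r,c)`-LDPC codes), numbers `1 ≤ d i ≤` the relevant distance, ANY minimum-weight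
decoders, and subexponential size `n i · r^{d i} → 0` for all `0 < r < 1`, the value `(2ze)⁻²` is a lower bound on
the accuracy threshold under independent errors: every `0 ≤ p < 1/(2ze)²` has failure probability `→ 0`.
UNCONDITIONAL, kernel-tier (assembles `sum_decodingFails_bernoulli_le_printed`).
[cite: Gottesman2014, Thm 3 (§4, arXiv:1310.2984 p0010 L20 – p0011 L12)] -/
theorem ldpc_isThresholdLowerBound_printed (H : ∀ i, Matrix (Fin (m i)) (Fin (n i)) (ZMod 2))
    (SX : ∀ i, Submodule (ZMod 2) (Fin (n i) → ZMod 2))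
    (D : ∀ i, (Fin (m i) → ZMod 2) → (Fin (n i) → ZMod 2)) (hD : ∀ i, IsMinWeightDecoder (H i) (D i))
    (d : ℕ → ℕ) (hd1 : ∀ i, 1 ≤ d i)
    (hd : ∀ i (x : Fin (n i) → ZMod 2), H i *ᵥ x = 0 → x ∉ SX i → d i ≤ hammingNorm x)
    {z : ℕ} (hz : 1 ≤ z)
    (hdeg : ∀ i, ∀ [DecidableRel (checkGraph (H i)).Adj], ∀ v, (checkGraph (H i)).degree v ≤ z)
    (hgrowth : ∀ r : ℝ, 0 < r → r < 1 → Tendsto (fun i => (n i : ℝ) * r ^ d i) atTop (𝓝 0)) :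
    IsThresholdLowerBound (cssFailureFamily H SX D) (1 / (2 * (z : ℝ) * Real.exp 1) ^ 2) := by
  classical
  intro p hp₀ hpp
  set K : ℝ := (z : ℝ) * Real.exp 1 with hK
  have hz0 : (0 : ℝ) < z := Nat.cast_pos.2 (by omega)
  have hK0 : 0 < K := by rw [hK]; exact mul_pos hz0 (Real.exp_pos 1)
  -- `p ≤ 1`: the printed threshold is `≤ 1/(2e)² < 1`
  have hp₁ : p ≤ 1 := by
    have := printedThreshold_le_one hz
    linarith
  set ρ : ℝ := 2 * K * Real.sqrt p with hρ
  have hρ1 : ρ < 1 := two_mul_mul_exp_mul_sqrt_lt_one hz hpp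
  have hρ0 : 0 ≤ ρ := by rw [hρ]; positivity
  -- the finite-length bound, at every index
  have hbound : ∀ i, cssFailureFamily H SX D i p ≤ (n i : ℝ) * ρ ^ d i / (K * (1 - ρ)) := fun i =>
    sum_decodingFails_bernoulli_le_printed (H i) (SX i) (hD i) (hd1 i) (hd i) hz (hdeg i) hp₀ hp₁ hρ1
  -- the right-hand side tends to `0`
  have hQ : Tendsto (fun i => (n i : ℝ) * ρ ^ d i / (K * (1 - ρ))) atTop (𝓝 0) := by
    rcases hρ0.eq_or_lt with hρ00 | hρpos
    · have : (fun i => (n i : ℝ) * ρ ^ d i / (K * (1 - ρ))) = fun _ => 0 := by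
        funext i
        rw [← hρ00, zero_pow (by have := hd1 i; omega)]
        simp
      rw [this]
      exact tendsto_const_nhds
    · have h := (hgrowth ρ hρpos hρ1).div_const (K * (1 - ρ))
      simpa using h
  have hQ' : BelowThreshold (fun i (_ : ℝ) => (n i : ℝ) * ρ ^ d i / (K * (1 - ρ))) p := hQ
  exact BelowThreshold.of_le (P := cssFailureFamily H SX D) hQ'
    (fun i => cssFailureFamily_nonneg H SX D i hp₀ hp₁) hbound

/-- Hence **`(2ze)⁻² ≤ accuracyThreshold`** of the family (DKLP §4.3 threshold of `CodeCapacityNoise.lean`).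
[cite: Gottesman2014, Thm 3 ("there exists a threshold p₀")] -/
theorem printedThreshold_le_accuracyThreshold (H : ∀ i, Matrix (Fin (m i)) (Fin (n i)) (ZMod 2))
    (SX : ∀ i, Submodule (ZMod 2) (Fin (n i) → ZMod 2))
    (D : ∀ i, (Fin (m i) → ZMod 2) → (Fin (n i) → ZMod 2)) (hD : ∀ i, IsMinWeightDecoder (H i) (D i))
    (d : ℕ → ℕ) (hd1 : ∀ i, 1 ≤ d i)
    (hd : ∀ i (x : Fin (n i) → ZMod 2), H i *ᵥ x = 0 → x ∉ SX i → d i ≤ hammingNorm x)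
    {z : ℕ} (hz : 1 ≤ z)
    (hdeg : ∀ i, ∀ [DecidableRel (checkGraph (H i)).Adj], ∀ v, (checkGraph (H i)).degree v ≤ z)
    (hgrowth : ∀ r : ℝ, 0 < r → r < 1 → Tendsto (fun i => (n i : ℝ) * r ^ d i) atTop (𝓝 0)) :
    1 / (2 * (z : ℝ) * Real.exp 1) ^ 2 ≤ accuracyThreshold (cssFailureFamily H SX D) :=
  le_accuracyThreshold (ldpc_isThresholdLowerBound_printed H SX D hD d hd1 hd hz hdeg hgrowth)
    (printedThreshold_le_one hz)

/-- **The printed constant supersedes the earlier one**: for check graphs of degree `≤ z` with `z ≥ 3`, the printed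
threshold bound `(2ze)⁻²` implies the tree's earlier `1/(4z⁴)` (`IsThresholdLowerBound` is downward closed and
`1/(4z⁴) ≤ (2ze)⁻²`, `animalThreshold_le_printedThreshold`). [cite: Gottesman2014, Thm 3 (p₀ = (2ze)⁻²)] -/
theorem ldpc_isThresholdLowerBound_of_three_le (H : ∀ i, Matrix (Fin (m i)) (Fin (n i)) (ZMod 2))
    (SX : ∀ i, Submodule (ZMod 2) (Fin (n i) → ZMod 2))
    (D : ∀ i, (Fin (m i) → ZMod 2) → (Fin (n i) → ZMod 2)) (hD : ∀ i, IsMinWeightDecoder (H i) (D i))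
    (d : ℕ → ℕ) (hd1 : ∀ i, 1 ≤ d i)
    (hd : ∀ i (x : Fin (n i) → ZMod 2), H i *ᵥ x = 0 → x ∉ SX i → d i ≤ hammingNorm x)
    {z : ℕ} (hz : 3 ≤ z)
    (hdeg : ∀ i, ∀ [DecidableRel (checkGraph (H i)).Adj], ∀ v, (checkGraph (H i)).degree v ≤ z)
    (hgrowth : ∀ r : ℝ, 0 < r → r < 1 → Tendsto (fun i => (n i : ℝ) * r ^ d i) atTop (𝓝 0)) :
    IsThresholdLowerBound (cssFailureFamily H SX D) (1 / (4 * (z : ℝ) ^ 4)) :=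
  (ldpc_isThresholdLowerBound_printed H SX D hD d hd1 hd (by omega) hdeg hgrowth).anti
    (animalThreshold_le_printedThreshold hz)

end Summit.Ventures.QEC.Thresholds

end
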